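import Literature.MathematicalPhysics.QuantumFieldTheory.Federbush1986.GoodSquareReweighting536
import Literature.MathematicalPhysics.QuantumFieldTheory.Federbush1986.ContourSlideHomotopy

/-!
# Federbush, *A phase cell approach to Yang–Mills theory* III [Federbush1987PhaseCellIII] — §5.3 step 11) p. 305:
# «To each bad square, say BS, we find c₁₀ good squares GS_α that are each parallel displacements of BS in the direction of
# n … distance ≦ c₁₁» — THE SELECTION OF THE GOOD TRANSLATES, with removed-point-free interiors, boundaries and slabs, outside
# an explicit `O(N)` exclusion set (step 6) p. 304 «a reasonable choice of … the additional bonds and vertices removed in 2)»)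

statement-level skeleton of published theorems with citation tags; proofs where landed; nothing here is a claim about the Yang–Mills mass gap

SOURCE. [Federbush1987PhaseCellIII] P. Federbush, *A phase cell approach to Yang–Mills theory III. Local stability, modified
renormalization group transformation*, Commun. Math. Phys. **110** (1987) 293–309 (held `paper:url-4700a514f365`; pp. 304–305
= PDF pp. 12–13 read this session from a raster render of the CCITT page images, displays legible).  THE PRINT, p. 305:
*«9) … Although the square contours summed over in (5.34) lie in the nice lattice, not all their "interiors" do. … The number
of such "bad squares" is easily estimated to be ≦ cN² in number, but this is too many to be moved over to the error term E″.
… 10) Given any ε > 0, we will show in the next step that we may rewrite (5.34) as (1/N⁴) Σ_{GS} α(GS) A^n_{GS} + E‴ (5.36)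
with 1 ≦ α(GS) ≦ 1 + ε, (5.37) … 11) We pick one of the two lattice directions, say n, perpendicular to the plane of P. To each
bad square, say BS, we find c₁₀ good squares GS_α that are each parallel displacements of BS in the direction of n. We can also
require that the distance between BS and each GS_α is ≦ c₁₁ lattice spacings. We then can write A^n_{BS} = (1/c₁₀) Σ_α
A^n_{GS_α} + e(BS) (5.39) with |e(BS)| ≦ c₁₂Na. (5.40) (c₁₂ will depend on c₁₀.) Equations (5.39) and (5.40) are derived by
relating the contour BS to each of the BS_α by a sequence of elementary homotopies … If c₁₀ is picked large enough (as a
function of ε) we can achieve (5.36) and (5.37).»*; p. 304 step 6): *«This requires a reasonable choice of the balls in 1) and a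
reasonable choice of the additional bonds and vertices removed in 2).»*; p. 303: *«A number of constants arise that in general
will depend on the positions of the l.f. plaquettes … we may choose the constants independent of l.f. plaquette positions …
Some of the constants will depend on N»*.

CITATION HEADER (lean-in-tree rule).  lit-balaban cell (HOME `run/shared/lean/pub/lit-balaban/`), Phase-2 proof seat p26
(gen 16; free-target protocol G.5-34(d), TAKING HOME/STATUS 2026-08-22T12:41Z), SKELETON row **F3.Eq5.26-5.40** (§5.3 steps
1)–12), owner r17, referee ref-5; head `typed` since SKELETON-r17 v3.85 — this file changes no head).  Companions BY NAME (none
edited): p32's `GoodSquareReweighting536` (p32 g10: the bookkeeping (5.34) ⇒ (5.36)–(5.37) GIVEN the families `F b` of good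
translates — `mult`, `weight`, `sum_eq536`, **`mult_le_of_translates`** whose hypothesis shape `g = b + j•e_n, |j| ≦ c₁₁` this
file produces; its HONEST SCOPE (b) «the existence, for each bad square, of c₁₀ GOOD translates within distance c₁₁ … is not
derived» is what is derived here), `ContourSlideHomotopy` (p32 g9: `slabPlaqs ν Γ t`, the plaquettes swept when `Γ` is displaced
by `t e_ν`, and `dist_wordHol_slideWordN_le` — (5.40)'s mechanism under the hypothesis that every slab plaquette is s.f.),
`Regime2SquareCounts` (p32 g10: the template count `card_filter_exists_le`, `bdTemplate`, `exists_bdTemplate_of_mem_rectLoop`,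
`exists_of_mem_rectPlaqs`; (5.35) and «bad squares ≦ cN²»), `Regime2SfBridge` (p32 g13: a plaquette NOT based at a removed base
point is s.f. — why cleanliness is phrased below as «base point ∉ D»), r17's `Lemma54RectangleStokes` (`rectLoop`, `rectPlaqs`)
and `Lemma56ContourCount` (`seg`; Bałaban's blocks `B6Elimination.block`).

WHAT IS PROVED (lattice `ℤ^d`, any `d`; a square = its corner `y : Site d`, plane directions `μ, ν`, side `N`, boundary contour
`rectLoop y μ ν N N`, interior plaquettes `rectPlaqs y μ ν N N`; the displacement direction `ℓ ∉ {μ, ν}` («n, perpendicular to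
the plane of P»); a finite set `D` of REMOVED base points (print's balls and removed vertices: a plaquette based outside `D` is
s.f.); a finite set `Sp` of SPOILED corners (any — e.g. the corners whose contours are not nice); the window `W = [−c₁₁, c₁₁]`):
* §1 the two counting devices: `exists_subset_card_eq_sdiff` (pigeonhole: `c + #(C ∩ S) ≦ #C ⟹` a `c`-subset of `C ∖ S`) and
  the DOUBLE COUNT `sum_spoilCount_le` / **`card_filter_lt_spoilCount_mul_le`**: the corners having more than `q` spoiled
  translates `y + h e_ℓ`, `h ∈ W`, number at most `#W·#Sp/(q+1)` (Markov);
* §2 the geometry of translates: base points of the contour bonds (`exists_bdBase_of_mem_rectLoop`, offsets `bdBase`, `≦ 4N` of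
  them), of the slab plaquettes (`exists_bdBase_of_mem_slabPlaqs`: `y + o + k e_ℓ`, `k < t`) and of the interior plaquettes
  (`apply_ell_of_mem_rectPlaqs`: the `ℓ`-coordinate of an interior base point of the square at `y + h e_ℓ` is `y_ℓ + h`, so ONE
  removed point spoils the interior of at most ONE translate: **`card_filter_interior_le`** `≦ #D`);
* §3 `LineHit D μ ν ℓ N W y` := an `ℓ`-line through a contour base point of the square `y` meets `D` within the window; its
  negation makes EVERY translate's contour and EVERY slab between `y` and `y ± t e_ℓ`, `t ≦ c₁₁`, free of removed base points
  (`rectLoop_clean_of_not_lineHit`, **`slab_clean_of_not_lineHit`**), and the corners with a line hit are few: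
  **`card_filter_lineHit_le`** `≦ #W·4N·#D` (template count) — with `#D ≦ r₁` per block this is print's `O(N)`;
* §4 THE SELECTION (**`exists_goodTranslates_up`**, **`exists_goodTranslates_down`**): if `c₁₀ + q + #D ≦ c₁₁`, the square `y`
  has no line hit in the window and at most `q` spoiled translates there, then on EITHER side there is a set `F` of EXACTLY `c₁₀`
  translates `g = y ± t e_ℓ`, `0 < t ≦ c₁₁`, each NOT spoiled, with interior, contour and the whole slab between `y` and `g` free
  of removed base points; **`exists_goodTranslates_block`**: inside Bałaban's block of corners `block N c` with `2c₁₁ + 1 ≦ N`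
  one side always has room, so `F ⊆ block N c`, with the membership shape `g = y + j•e_ℓ, |j| ≦ c₁₁` of `mult_le_of_translates`;
* §5 THE REASONABLE CHOICE (**`exists_goodTranslates_family`**): for every block of corners there are an exclusion set
  `X ⊆ block N c` with `#X ≦ (2c₁₁+1)·4N·#D + (2c₁₁+1)·#Sp/(q+1)` and families `F y` such that every corner `y ∈ block N c ∖ X`
  has `#F y = c₁₀` translates as in §4, and `GoodSquareReweighting.mult Bad F g ≦ 2c₁₁ + 1` for every `Bad` and `g` — the
  fields `F`, `card_F`, `mult_le` (and the s.f.-slab input of the `chain`/(5.39) field) of p32's `Regime2Datum` for the corners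
  kept.  Reading: the squares of `X` are the ones print removes by its «reasonable choice» (their number is `O(N)`, the order of
  (5.30)/(5.35), not the `O(N²)` of the bad squares).
* §6 (v1.1) THE ORDER OF CONSTANTS of (5.37): **`mult_le_card_removed`** — when the bad squares are the ones with an interior
  plaquette based in `D` and the families consist of translates along `e_ℓ`, every multiplicity is `≦ #D` (NOT merely `≦ 2c₁₁ + 1`),
  so (5.37) holds with `ε = #D/c₁₀`, small for «c₁₀ … large enough (as a function of ε)»; `mult_le_card_removed_of_kept` for the
  families of §5.

HONEST SCOPE.  (a) Print does not say how the `c₁₀` translates are found nor that some squares must first be discarded; a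
straight slab CAN be blocked on both sides of a single square (a removed point just above and one just below its contour), so a
per-square unconditional selection is false and the `O(N)` exclusion of §5 is this file's reading of step 6)'s «reasonable
choice … of the additional bonds and vertices removed».  (b) «Good» is delivered as: not in `Sp`, interior/contour/slab base
points outside `D`; turning «base point ∉ D» into «s.f.» is p32's `Regime2SfBridge.absG_plaqLoop_lt_of_not_mem`, and (5.39)–
(5.40) themselves are p32's `ContourSlideHomotopy`/`BadSquareComparison539` — not re-proved here.  (c) Constants: `c₁₁ = c₁₀ +
q + #D` and the exclusion bound are explicit; «c₁₀ large as a function of ε» is `GoodSquareReweighting.weight_le`.  No `def … :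
Prop` hypothesis, no `sorry`; three small `def`s with bodies (`spoilCount`, `bdBase`, `LineHit`); axioms standard.  Unit
`lit-balaban-p26` (literature-prover-lit-balaban-p26-g16-0).
-/

namespace Literature.MathematicalPhysics.QuantumFieldTheory.Federbush1986

namespace GoodSquareTranslates

open LatticeContour Regime2SquareCounts
open Literature.MathematicalPhysics.QuantumFieldTheory.Balaban1983to89.B6Elimination (block mem_block)
open scoped BigOperators

variable {d : ℕ}

/-! ## §1 Pigeonhole and the double count -/

/-- **Pigeonhole.** If `c + #(C ∩ S) ≦ #C` then `C ∖ S` contains a subset of exactly `c` elements («we find c₁₀ good squares»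
among `c₁₁` candidates of which few are spoiled). [cite: Federbush1987PhaseCellIII, §5.3 11) p. 305] -/
theorem exists_subset_card_eq_sdiff {α : Type*} [DecidableEq α] (C S : Finset α) {c : ℕ}
    (h : c + (C ∩ S).card ≤ C.card) : ∃ T ⊆ C \ S, T.card = c := by
  apply Finset.exists_subset_card_eq
  have := Finset.card_sdiff_add_card_inter C S
  omega

/-- The number of SPOILED TRANSLATES of the corner `y`: heights `h` of the window `W` with `y + h e_ℓ ∈ Sp`.
[cite: Federbush1987PhaseCellIII, §5.3 11) p. 305] -/
def spoilCount (Sp : Finset (Site d)) (ℓ : Fin d) (W : Finset ℤ) (y : Site d) : ℕ :=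
  (W.filter fun h => y + h • ev ℓ ∈ Sp).card

/-- Unfolding `spoilCount`. [cite: Federbush1987PhaseCellIII, §5.3 11) p. 305] -/
theorem spoilCount_def (Sp : Finset (Site d)) (ℓ : Fin d) (W : Finset ℤ) (y : Site d) :
    spoilCount Sp ℓ W y = (W.filter fun h => y + h • ev ℓ ∈ Sp).card := rfl

/-- **The double count**: summed over any family of corners, the spoiled translates number at most `#W · #Sp` (each height
`h` translates the family injectively). [cite: Federbush1987PhaseCellIII, §5.3 6) p. 304, 11) p. 305] -/
theorem sum_spoilCount_le (Y Sp : Finset (Site d)) (ℓ : Fin d) (W : Finset ℤ) :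
    ∑ y ∈ Y, spoilCount Sp ℓ W y ≤ W.card * Sp.card := by
  classical
  calc ∑ y ∈ Y, spoilCount Sp ℓ W y
      = ∑ y ∈ Y, ∑ h ∈ W, (if y + h • ev ℓ ∈ Sp then 1 else 0) := by
        refine Finset.sum_congr rfl fun y _ => ?_
        rw [spoilCount, Finset.card_filter]
    _ = ∑ h ∈ W, ∑ y ∈ Y, (if y + h • ev ℓ ∈ Sp then 1 else 0) := Finset.sum_comm
    _ = ∑ h ∈ W, (Y.filter fun y => y + h • ev ℓ ∈ Sp).card := by
        refine Finset.sum_congr rfl fun h _ => ?_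
        rw [Finset.card_filter]
    _ ≤ ∑ _h ∈ W, Sp.card := by
        refine Finset.sum_le_sum fun h _ => ?_
        refine Finset.card_le_card_of_injOn (fun y => y + h • ev ℓ) (fun y hy => ?_) ?_
        · exact (Finset.mem_filter.1 (Finset.mem_coe.1 hy)).2
        · intro y _ y' _ hyy'
          exact add_right_cancel hyy'
    _ = W.card * Sp.card := by rw [Finset.sum_const, smul_eq_mul]

/-- **Markov's inequality for the spoiled translates**: the corners of `Y` having MORE THAN `q` spoiled translates in the window
number at most `#W · #Sp / (q + 1)`. [cite: Federbush1987PhaseCellIII, §5.3 6) p. 304, 11) p. 305] -/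
theorem card_filter_lt_spoilCount_mul_le (Y Sp : Finset (Site d)) (ℓ : Fin d) (W : Finset ℤ) (q : ℕ)
    [DecidablePred fun y => q < spoilCount Sp ℓ W y] :
    (Y.filter fun y => q < spoilCount Sp ℓ W y).card * (q + 1) ≤ W.card * Sp.card := by
  classical
  calc (Y.filter fun y => q < spoilCount Sp ℓ W y).card * (q + 1)
      ≤ ∑ y ∈ Y.filter (fun y => q < spoilCount Sp ℓ W y), spoilCount Sp ℓ W y := by
        have h := Finset.card_nsmul_le_sum (Y.filter fun y => q < spoilCount Sp ℓ W y) (spoilCount Sp ℓ W) (q + 1)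
          (fun y hy => (Finset.mem_filter.1 hy).2)
        simpa [smul_eq_mul] using h
    _ ≤ ∑ y ∈ Y, spoilCount Sp ℓ W y := Finset.sum_le_sum_of_subset (Finset.filter_subset _ _)
    _ ≤ W.card * Sp.card := sum_spoilCount_le Y Sp ℓ W

/-! ## §2 Base points of the contour, of the slabs and of the interiors of the translates -/

/-- The offsets (from the corner) of the base points of the `4N` bonds of the square contour. [cite: Federbush1987PhaseCellIII,
§5.1 Fig. 5 p. 300, §5.3 8) p. 304] -/
noncomputable def bdBase (μ ν : Fin d) (N : ℕ) : Finset (Site d) := (bdTemplate μ ν N N).image Prod.fst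

/-- At most `4N` contour base points. [cite: Federbush1987PhaseCellIII, §5.3 8) p. 304] -/
theorem card_bdBase_le (μ ν : Fin d) (N : ℕ) : (bdBase μ ν N).card ≤ 4 * N :=
  Finset.card_image_le.trans (by have := card_bdTemplate_le (d := d) μ ν N N; omega)

/-- Every bond of the square contour at `y` is based at `y + o` for a boundary offset `o`. [cite: Federbush1987PhaseCellIII,
§5.1 p. 300, §5.3 11) p. 305] -/
theorem exists_bdBase_of_mem_rectLoop (y : Site d) (μ ν : Fin d) (N : ℕ) {l : Letter d}
    (hl : l ∈ rectLoop y μ ν N N) : ∃ o ∈ bdBase μ ν N, l.1.1 = y + o := by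
  obtain ⟨t, ht, he⟩ := exists_bdTemplate_of_mem_rectLoop y μ ν N N hl
  exact ⟨t.1, Finset.mem_image.2 ⟨t, ht, rfl⟩, by rw [he]⟩

/-- **Base points of the slab.** Every plaquette of the slab swept when the square contour at `y` is displaced by `t e_ℓ` is
based at `y + o + k e_ℓ` with `o` a boundary offset and `k < t` («the distance between BS and each GS_α is ≦ c₁₁ lattice
spacings»). [cite: Federbush1987PhaseCellIII, §5.3 11) p. 305] -/
theorem exists_bdBase_of_mem_slabPlaqs (y : Site d) (μ ν ℓ : Fin d) (N t : ℕ) {q : LatticeContour.Plaq d}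
    (hq : q ∈ slabPlaqs ℓ (rectLoop y μ ν N N) t) :
    ∃ o ∈ bdBase μ ν N, ∃ k : ℕ, k < t ∧ q.1 = y + o + (k : ℤ) • ev ℓ := by
  obtain ⟨l, hl, k, hk, -, hq⟩ := mem_slabPlaqs ℓ t q hq
  obtain ⟨o, ho, he⟩ := exists_bdBase_of_mem_rectLoop y μ ν N hl
  refine ⟨o, ho, k, hk, ?_⟩
  rcases hq with rfl | rfl <;> simp [he]

/-- **Base points of the interior.** The `ℓ`-coordinate (`ℓ ∉ {μ, ν}`) of the base point of an interior plaquette of the square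
at `y + h e_ℓ` is `y_ℓ + h`. [cite: Federbush1987PhaseCellIII, §5.3 9) p. 305] -/
theorem apply_ell_of_mem_rectPlaqs {μ ν ℓ : Fin d} (hμ : ℓ ≠ μ) (hν : ℓ ≠ ν) (y : Site d) (N : ℕ) (h : ℤ)
    {p : LatticeContour.Plaq d} (hp : p ∈ rectPlaqs (y + h • ev ℓ) μ ν N N) : p.1 ℓ = y ℓ + h := by
  obtain ⟨s, -, t, -, rfl⟩ := exists_of_mem_rectPlaqs (y + h • ev ℓ) μ ν N N hp
  simp [Pi.add_apply, ev_apply_of_ne hμ, ev_apply_of_ne hν]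

/-- **One removed point spoils the interior of at most one translate**: along the `ℓ`-line through `y`, the heights whose
square has an interior plaquette based in `D` number at most `#D`. [cite: Federbush1987PhaseCellIII, §5.3 9) p. 305, 11)
p. 305] -/
theorem card_filter_interior_le (D : Finset (Site d)) {μ ν ℓ : Fin d} (hμ : ℓ ≠ μ) (hν : ℓ ≠ ν) (y : Site d) (N : ℕ)
    (W : Finset ℤ) [DecidablePred fun h : ℤ => ∃ p ∈ rectPlaqs (y + h • ev ℓ) μ ν N N, p.1 ∈ D] :
    (W.filter fun h : ℤ => ∃ p ∈ rectPlaqs (y + h • ev ℓ) μ ν N N, p.1 ∈ D).card ≤ D.card := by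
  classical
  refine le_trans (Finset.card_le_card (t := D.image fun z => z ℓ - y ℓ) ?_) Finset.card_image_le
  intro h hh
  obtain ⟨-, p, hp, hD⟩ := Finset.mem_filter.1 hh
  refine Finset.mem_image.2 ⟨p.1, hD, ?_⟩
  simp [apply_ell_of_mem_rectPlaqs hμ hν y N h hp]

/-! ## §3 Line hits: the squares whose slabs can be obstructed -/

/-- `LineHit D μ ν ℓ N W y`: some `ℓ`-line through a base point of the contour of the square `y` meets the removed set `D` at a
height of the window `W` — the squares that the «reasonable choice of … the additional bonds and vertices removed» discards.
[cite: Federbush1987PhaseCellIII, §5.3 6) p. 304, 11) p. 305] -/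
def LineHit (D : Finset (Site d)) (μ ν ℓ : Fin d) (N : ℕ) (W : Finset ℤ) (y : Site d) : Prop :=
  ∃ t ∈ W ×ˢ bdBase μ ν N, y + t.2 + t.1 • ev ℓ ∈ D

/-- Line hits are decidable (a finite search). [cite: Federbush1987PhaseCellIII, §5.3 11) p. 305] -/
noncomputable instance instDecidablePredLineHit (D : Finset (Site d)) (μ ν ℓ : Fin d) (N : ℕ) (W : Finset ℤ) :
    DecidablePred (LineHit D μ ν ℓ N W) := fun y => by
  unfold LineHit
  infer_instance

/-- No line hit: no point `y + o + j e_ℓ`, `o` a boundary offset, `j ∈ W`, is removed. [cite: Federbush1987PhaseCellIII,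
§5.3 11) p. 305] -/
theorem not_mem_of_not_lineHit {D : Finset (Site d)} {μ ν ℓ : Fin d} {N : ℕ} {W : Finset ℤ} {y : Site d}
    (h : ¬ LineHit D μ ν ℓ N W y) {o : Site d} (ho : o ∈ bdBase μ ν N) {j : ℤ} (hj : j ∈ W) :
    y + o + j • ev ℓ ∉ D :=
  fun hD => h ⟨(j, o), Finset.mem_product.2 ⟨hj, ho⟩, hD⟩

/-- **No line hit ⟹ every translate's contour avoids the removed base points.** [cite: Federbush1987PhaseCellIII, §5.3
11) p. 305] -/
theorem rectLoop_clean_of_not_lineHit {D : Finset (Site d)} {μ ν ℓ : Fin d} {N : ℕ} {W : Finset ℤ} {y : Site d}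
    (h : ¬ LineHit D μ ν ℓ N W y) {j : ℤ} (hj : j ∈ W) :
    ∀ l ∈ rectLoop (y + j • ev ℓ) μ ν N N, l.1.1 ∉ D := by
  intro l hl
  obtain ⟨o, ho, he⟩ := exists_bdBase_of_mem_rectLoop _ μ ν N hl
  rw [he, add_right_comm]
  exact not_mem_of_not_lineHit h ho hj

/-- **No line hit ⟹ the slab between the translates at heights `j` and `j + t` avoids the removed base points**, provided
the heights `j, …, j + t − 1` lie in the window — the s.f. input of `ContourSlideHomotopy.dist_wordHol_slideWordN_le` through
`Regime2SfBridge`. [cite: Federbush1987PhaseCellIII, §5.3 11) p. 305] -/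
theorem slab_clean_of_not_lineHit {D : Finset (Site d)} {μ ν ℓ : Fin d} {N : ℕ} {W : Finset ℤ} {y : Site d}
    (h : ¬ LineHit D μ ν ℓ N W y) {j : ℤ} {t : ℕ} (hW : ∀ k : ℕ, k < t → j + k ∈ W) :
    ∀ q ∈ slabPlaqs ℓ (rectLoop (y + j • ev ℓ) μ ν N N) t, q.1 ∉ D := by
  intro q hq
  obtain ⟨o, ho, k, hk, he⟩ := exists_bdBase_of_mem_slabPlaqs _ μ ν ℓ N t hq
  have e : y + j • ev ℓ + o + (k : ℤ) • ev ℓ = y + o + (j + k) • ev ℓ := by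
    rw [add_smul]; abel
  rw [he, e]
  exact not_mem_of_not_lineHit h ho (hW k hk)

/-- **The squares with a line hit are few**: among any family `Y` of corners at most `#W · 4N · #D` have a line hit (each
removed point, height and boundary offset determine the corner). [cite: Federbush1987PhaseCellIII, §5.3 6) p. 304 with (5.30),
(5.35) p. 305] -/
theorem card_filter_lineHit_le (D Y : Finset (Site d)) (μ ν ℓ : Fin d) (N : ℕ) (W : Finset ℤ) :
    (Y.filter (LineHit D μ ν ℓ N W)).card ≤ W.card * (4 * N) * D.card := by
  classical
  have hT := card_filter_exists_le Y (W ×ˢ bdBase μ ν N) D (fun y t => y + t.2 + t.1 • ev ℓ)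
    (fun t _ => by
      intro y _ y' _ hyy'
      simpa using hyy')
  calc (Y.filter (LineHit D μ ν ℓ N W)).card
      = (Y.filter fun y => ∃ t ∈ W ×ˢ bdBase μ ν N, y + t.2 + t.1 • ev ℓ ∈ D).card := by
        unfold LineHit; congr 1
    _ ≤ (W ×ˢ bdBase μ ν N).card * D.card := hT
    _ ≤ W.card * (4 * N) * D.card := by
        rw [Finset.card_product]
        exact Nat.mul_le_mul_right _ (Nat.mul_le_mul_left _ (card_bdBase_le μ ν N))

/-! ## §4 The selection of the `c₁₀` good translates -/

/-- **The heights.** If `c₁₀ + q + #D ≦ c₁₁`, at most `q` translates of `y` in the window `[−c₁₁, c₁₁]` are spoiled, then for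
either sign `σ = ±1` there are EXACTLY `c₁₀` heights `t ∈ [1, c₁₁]` whose translate `y + σt e_ℓ` is not spoiled and has no
interior plaquette based at a removed point. [cite: Federbush1987PhaseCellIII, §5.3 11) p. 305] -/
theorem exists_heights (D Sp : Finset (Site d)) {μ ν ℓ : Fin d} (hμ : ℓ ≠ μ) (hν : ℓ ≠ ν) (N : ℕ) {c10 q c11 : ℕ}
    (hc : c10 + q + D.card ≤ c11) (y : Site d) {σ : ℤ} (hσ : σ = 1 ∨ σ = -1)
    (hsp : spoilCount Sp ℓ (Finset.Icc (-(c11 : ℤ)) c11) y ≤ q) :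
    ∃ T : Finset ℕ, T ⊆ Finset.Icc 1 c11 ∧ T.card = c10 ∧ ∀ t ∈ T,
      y + (σ * t) • ev ℓ ∉ Sp ∧ ∀ p ∈ rectPlaqs (y + (σ * t) • ev ℓ) μ ν N N, p.1 ∉ D := by
  classical
  set C : Finset ℕ := Finset.Icc 1 c11 with hC
  set S₁ : Finset ℕ := C.filter fun t => y + (σ * t) • ev ℓ ∈ Sp with hS₁
  set S₂ : Finset ℕ := C.filter fun t => ∃ p ∈ rectPlaqs (y + (σ * t) • ev ℓ) μ ν N N, p.1 ∈ D with hS₂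
  -- the signed height is injective and lands in the window
  have hinj : Set.InjOn (fun t : ℕ => σ * (t : ℤ)) (C : Set ℕ) := by
    intro t _ t' _ htt'
    rcases hσ with rfl | rfl <;> simp at htt' <;> exact_mod_cast htt'
  have hwin : ∀ t ∈ C, σ * (t : ℤ) ∈ Finset.Icc (-(c11 : ℤ)) c11 := by
    intro t ht
    rw [hC, Finset.mem_Icc] at ht
    rw [Finset.mem_Icc]
    rcases hσ with rfl | rfl <;> constructor <;> omega
  have h1 : S₁.card ≤ q := by
    refine le_trans ?_ hsp
    rw [spoilCount]
    refine Finset.card_le_card_of_injOn (fun t : ℕ => σ * (t : ℤ)) (fun t ht => ?_) (hinj.mono ?_)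
    · have ht' := Finset.mem_filter.1 (Finset.mem_coe.1 ht)
      exact Finset.mem_coe.2 (Finset.mem_filter.2 ⟨hwin t ht'.1, ht'.2⟩)
    · exact Finset.coe_subset.2 (Finset.filter_subset _ _)
  have h2 : S₂.card ≤ D.card := by
    refine le_trans ?_ (card_filter_interior_le D hμ hν y N (C.image fun t : ℕ => σ * (t : ℤ)))
    refine Finset.card_le_card_of_injOn (fun t : ℕ => σ * (t : ℤ)) (fun t ht => ?_) (hinj.mono ?_)
    · have ht' := Finset.mem_filter.1 (Finset.mem_coe.1 ht)
      exact Finset.mem_coe.2 (Finset.mem_filter.2 ⟨Finset.mem_image.2 ⟨t, ht'.1, rfl⟩, ht'.2⟩)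
    · exact Finset.coe_subset.2 (Finset.filter_subset _ _)
  have hCS : c10 + (C ∩ (S₁ ∪ S₂)).card ≤ C.card := by
    have : (C ∩ (S₁ ∪ S₂)).card ≤ S₁.card + S₂.card :=
      (Finset.card_le_card Finset.inter_subset_right).trans (Finset.card_union_le _ _)
    rw [hC, Nat.card_Icc]
    rw [← hC]
    omega
  obtain ⟨T, hT, hTc⟩ := exists_subset_card_eq_sdiff C (S₁ ∪ S₂) hCS
  refine ⟨T, fun t ht => (Finset.mem_sdiff.1 (hT ht)).1, hTc, fun t ht => ?_⟩
  have htC := (Finset.mem_sdiff.1 (hT ht)).1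
  have htS := (Finset.mem_sdiff.1 (hT ht)).2
  rw [Finset.mem_union, not_or] at htS
  refine ⟨fun hs => htS.1 (Finset.mem_filter.2 ⟨htC, hs⟩), fun p hp hD => htS.2 (Finset.mem_filter.2 ⟨htC, p, hp, hD⟩)⟩

/-- Distinct heights give distinct translates. [cite: Federbush1987PhaseCellIII, §5.3 11) p. 305] -/
theorem translate_injective (y : Site d) (ℓ : Fin d) : Function.Injective fun j : ℤ => y + j • ev ℓ := by
  intro j j' h
  have := congrFun h ℓ
  simpa [Pi.add_apply, Pi.smul_apply] using this

/-- **Step 11) UPWARDS.** Under the hypotheses of `exists_heights` and NO LINE HIT in the window, there are exactly `c₁₀`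
translates `g = y + t e_ℓ`, `0 < t ≦ c₁₁` («parallel displacements of BS in the direction of n … distance ≦ c₁₁»), each not
spoiled, with interior and contour based outside `D`, and with the whole slab between `y` and `g` based outside `D`.
[cite: Federbush1987PhaseCellIII, §5.3 11) p. 305] -/
theorem exists_goodTranslates_up (D Sp : Finset (Site d)) {μ ν ℓ : Fin d} (hμ : ℓ ≠ μ) (hν : ℓ ≠ ν) (N : ℕ)
    {c10 q c11 : ℕ} (hc : c10 + q + D.card ≤ c11) (y : Site d)
    (hline : ¬ LineHit D μ ν ℓ N (Finset.Icc (-(c11 : ℤ)) c11) y)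
    (hsp : spoilCount Sp ℓ (Finset.Icc (-(c11 : ℤ)) c11) y ≤ q) :
    ∃ F : Finset (Site d), F.card = c10 ∧ ∀ g ∈ F, ∃ t : ℕ, 0 < t ∧ t ≤ c11 ∧ g = y + (t : ℤ) • ev ℓ ∧
      g ∉ Sp ∧ (∀ p ∈ rectPlaqs g μ ν N N, p.1 ∉ D) ∧ (∀ l ∈ rectLoop g μ ν N N, l.1.1 ∉ D) ∧
      ∀ q' ∈ slabPlaqs ℓ (rectLoop y μ ν N N) t, q'.1 ∉ D := by
  classical
  obtain ⟨T, hTC, hTc, hT⟩ := exists_heights D Sp hμ hν N hc y (σ := 1) (Or.inl rfl) hsp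
  refine ⟨T.image fun t : ℕ => y + (t : ℤ) • ev ℓ, ?_, ?_⟩
  · rw [Finset.card_image_of_injective _ fun t t' h => by
      have := translate_injective y ℓ h; exact_mod_cast this]
    exact hTc
  · intro g hg
    obtain ⟨t, ht, rfl⟩ := Finset.mem_image.1 hg
    have htI := Finset.mem_Icc.1 (hTC ht)
    obtain ⟨hsp', hint⟩ := hT t ht
    simp only [one_mul] at hsp' hint
    have htW : ((t : ℕ) : ℤ) ∈ Finset.Icc (-(c11 : ℤ)) c11 := by
      rw [Finset.mem_Icc]; constructor <;> omega
    refine ⟨t, htI.1, htI.2, rfl, hsp', hint, rectLoop_clean_of_not_lineHit hline htW, ?_⟩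
    have h0 := slab_clean_of_not_lineHit (t := t) hline (j := 0) (fun k hk => by
      rw [Finset.mem_Icc]; constructor <;> omega)
    simpa using h0

/-- **Step 11) DOWNWARDS**: the same with `g = y − t e_ℓ`, the slab now being the one swept from `g` up to `y`.
[cite: Federbush1987PhaseCellIII, §5.3 11) p. 305] -/
theorem exists_goodTranslates_down (D Sp : Finset (Site d)) {μ ν ℓ : Fin d} (hμ : ℓ ≠ μ) (hν : ℓ ≠ ν) (N : ℕ)
    {c10 q c11 : ℕ} (hc : c10 + q + D.card ≤ c11) (y : Site d)
    (hline : ¬ LineHit D μ ν ℓ N (Finset.Icc (-(c11 : ℤ)) c11) y)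
    (hsp : spoilCount Sp ℓ (Finset.Icc (-(c11 : ℤ)) c11) y ≤ q) :
    ∃ F : Finset (Site d), F.card = c10 ∧ ∀ g ∈ F, ∃ t : ℕ, 0 < t ∧ t ≤ c11 ∧ g = y + (-(t : ℤ)) • ev ℓ ∧
      g ∉ Sp ∧ (∀ p ∈ rectPlaqs g μ ν N N, p.1 ∉ D) ∧ (∀ l ∈ rectLoop g μ ν N N, l.1.1 ∉ D) ∧
      ∀ q' ∈ slabPlaqs ℓ (rectLoop g μ ν N N) t, q'.1 ∉ D := by
  classical
  obtain ⟨T, hTC, hTc, hT⟩ := exists_heights D Sp hμ hν N hc y (σ := -1) (Or.inr rfl) hsp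
  refine ⟨T.image fun t : ℕ => y + (-(t : ℤ)) • ev ℓ, ?_, ?_⟩
  · rw [Finset.card_image_of_injective _ fun t t' h => by
      have := translate_injective y ℓ h; simpa using this]
    exact hTc
  · intro g hg
    obtain ⟨t, ht, rfl⟩ := Finset.mem_image.1 hg
    have htI := Finset.mem_Icc.1 (hTC ht)
    obtain ⟨hsp', hint⟩ := hT t ht
    simp only [neg_mul, one_mul] at hsp' hint
    have htW : (-((t : ℕ) : ℤ)) ∈ Finset.Icc (-(c11 : ℤ)) c11 := by
      rw [Finset.mem_Icc]; constructor <;> omega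
    refine ⟨t, htI.1, htI.2, rfl, hsp', hint, rectLoop_clean_of_not_lineHit hline htW, ?_⟩
    exact slab_clean_of_not_lineHit (t := t) hline (j := -((t : ℕ) : ℤ)) (fun k hk => by
      rw [Finset.mem_Icc]; constructor <;> omega)

/-- **Room in the block.** In Bałaban's block of corners `block N c` with `2c₁₁ + 1 ≦ N`, every corner has all its `c₁₁`
translates on one side inside the block. [cite: Federbush1987PhaseCellIII, §5.3 1) p. 303, 11) p. 305] -/
theorem room_in_block {N c11 : ℕ} (hN : 2 * c11 + 1 ≤ N) (ℓ : Fin d) {c y : Site d} (hy : y ∈ block N c) :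
    (∀ t : ℕ, t ≤ c11 → y + (t : ℤ) • ev ℓ ∈ block N c) ∨ (∀ t : ℕ, t ≤ c11 → y + (-(t : ℤ)) • ev ℓ ∈ block N c) := by
  rw [mem_block] at hy
  have hyl := hy ℓ
  by_cases hup : y ℓ + c11 < c ℓ + N
  · refine Or.inl fun t ht => mem_block.2 fun i => ?_
    by_cases hi : i = ℓ
    · subst hi; simp [Pi.add_apply]; constructor <;> omega
    · have := hy i; simp [Pi.add_apply, ev_apply_of_ne hi]; exact this
  · refine Or.inr fun t ht => mem_block.2 fun i => ?_
    by_cases hi : i = ℓ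
    · subst hi; simp [Pi.add_apply]; constructor <;> omega
    · have := hy i; simp [Pi.add_apply, ev_apply_of_ne hi]; exact this

/-- **Step 11) inside the block of corners**: with `2c₁₁ + 1 ≦ N` a corner `y ∈ block N c` without line hit and with at most
`q` spoiled translates has a family `F ⊆ block N c` of exactly `c₁₀` translates `g = y + j e_ℓ`, `0 < |j| ≦ c₁₁` (the shape
consumed by `GoodSquareReweighting.mult_le_of_translates`), each not spoiled, interior and contour based outside `D`, and the
slab between `y` and `g` (swept from the lower of the two) based outside `D`. [cite: Federbush1987PhaseCellIII, §5.3 11)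
p. 305] -/
theorem exists_goodTranslates_block (D Sp : Finset (Site d)) {μ ν ℓ : Fin d} (hμ : ℓ ≠ μ) (hν : ℓ ≠ ν) {N : ℕ}
    {c10 q c11 : ℕ} (hc : c10 + q + D.card ≤ c11) (hN : 2 * c11 + 1 ≤ N) {c y : Site d} (hy : y ∈ block N c)
    (hline : ¬ LineHit D μ ν ℓ N (Finset.Icc (-(c11 : ℤ)) c11) y)
    (hsp : spoilCount Sp ℓ (Finset.Icc (-(c11 : ℤ)) c11) y ≤ q) :
    ∃ F : Finset (Site d), F.card = c10 ∧ ∀ g ∈ F, g ∈ block N c ∧ g ∉ Sp ∧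
      (∃ j : ℤ, |j| ≤ c11 ∧ g = y + j • ev ℓ) ∧
      (∀ p ∈ rectPlaqs g μ ν N N, p.1 ∉ D) ∧ (∀ l ∈ rectLoop g μ ν N N, l.1.1 ∉ D) ∧
      ∃ t : ℕ, 0 < t ∧ t ≤ c11 ∧
        ((g = y + (t : ℤ) • ev ℓ ∧ ∀ q' ∈ slabPlaqs ℓ (rectLoop y μ ν N N) t, q'.1 ∉ D) ∨
         (g = y + (-(t : ℤ)) • ev ℓ ∧ ∀ q' ∈ slabPlaqs ℓ (rectLoop g μ ν N N) t, q'.1 ∉ D)) := by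
  rcases room_in_block hN ℓ hy with hroom | hroom
  · obtain ⟨F, hFc, hF⟩ := exists_goodTranslates_up D Sp hμ hν N hc y hline hsp
    refine ⟨F, hFc, fun g hg => ?_⟩
    obtain ⟨t, ht0, htc, rfl, hsp', hint, hbd, hslab⟩ := hF g hg
    exact ⟨hroom t htc, hsp', ⟨t, by rw [Nat.abs_cast]; exact_mod_cast htc, rfl⟩, hint, hbd,
      t, ht0, htc, Or.inl ⟨rfl, hslab⟩⟩
  · obtain ⟨F, hFc, hF⟩ := exists_goodTranslates_down D Sp hμ hν N hc y hline hsp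
    refine ⟨F, hFc, fun g hg => ?_⟩
    obtain ⟨t, ht0, htc, rfl, hsp', hint, hbd, hslab⟩ := hF g hg
    exact ⟨hroom t htc, hsp', ⟨-(t : ℤ), by rw [abs_neg, Nat.abs_cast]; exact_mod_cast htc, rfl⟩, hint, hbd,
      t, ht0, htc, Or.inr ⟨rfl, hslab⟩⟩

/-! ## §5 The reasonable choice: an `O(N)` exclusion set and the families -/

/-- **The exclusion set.** For every family of corners `Y` there is `X ⊆ Y` with
`#X ≦ (2c₁₁+1)·4N·#D + (2c₁₁+1)·#Sp/(q+1)` off which no corner has a line hit or more than `q` spoiled translates in the window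
`[−c₁₁, c₁₁]` — the squares discarded by the «reasonable choice», `O(N)` of them. [cite: Federbush1987PhaseCellIII, §5.3 6)
p. 304, 11) p. 305] -/
theorem exists_exclusion (D Sp Y : Finset (Site d)) (μ ν ℓ : Fin d) (N q c11 : ℕ) :
    ∃ X ⊆ Y, X.card ≤ (2 * c11 + 1) * (4 * N) * D.card + (2 * c11 + 1) * Sp.card / (q + 1) ∧
      ∀ y ∈ Y, y ∉ X → ¬ LineHit D μ ν ℓ N (Finset.Icc (-(c11 : ℤ)) c11) y ∧
        spoilCount Sp ℓ (Finset.Icc (-(c11 : ℤ)) c11) y ≤ q := by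
  classical
  set W : Finset ℤ := Finset.Icc (-(c11 : ℤ)) c11 with hW
  -- the window has `2c₁₁ + 1` heights (the tree's `Torus.card_Icc_neg_self`, recomputed to keep the imports light)
  have hWc : W.card = 2 * c11 + 1 := by rw [hW, Int.card_Icc]; omega
  refine ⟨Y.filter (LineHit D μ ν ℓ N W) ∪ Y.filter (fun y => q < spoilCount Sp ℓ W y), ?_, ?_, ?_⟩
  · exact Finset.union_subset (Finset.filter_subset _ _) (Finset.filter_subset _ _)
  · refine (Finset.card_union_le _ _).trans (Nat.add_le_add ?_ ?_)
    · have h := card_filter_lineHit_le D Y μ ν ℓ N W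
      rwa [hWc] at h
    · have h := card_filter_lt_spoilCount_mul_le Y Sp ℓ W q
      rw [hWc] at h
      exact (Nat.le_div_iff_mul_le (Nat.succ_pos q)).2 h
  · intro y hy hyX
    rw [Finset.mem_union, not_or, Finset.mem_filter, Finset.mem_filter] at hyX
    exact ⟨fun h => hyX.1 ⟨hy, h⟩, not_lt.1 fun h => hyX.2 ⟨hy, h⟩⟩

/-- **Step 11) with step 6)'s reasonable choice, assembled for a block of corners.**  Given the removed base points `D`, the
spoiled corners `Sp`, `c₁₀ + q + #D ≦ c₁₁` and `2c₁₁ + 1 ≦ N`: there are an exclusion set `X ⊆ block N c` with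
`#X ≦ (2c₁₁+1)·4N·#D + (2c₁₁+1)·#Sp/(q+1)` and families `F` with, for every corner `y ∈ block N c` off `X`, `#F y = c₁₀`
translates in the block along `e_ℓ` at distance `≦ c₁₁`, not spoiled, interiors/contours/slabs based outside `D` — and
`mult Bad F g ≦ 2c₁₁ + 1` for all `Bad`, `g` (the fields `F`, `card_F`, `mult_le` of p32's `Regime2Datum` for the corners kept;
(5.37) with `ε = (2c₁₁+1)/c₁₀` by `GoodSquareReweighting.weight_le`). [cite: Federbush1987PhaseCellIII, §5.3 6) p. 304, 10)–11)
(5.36)–(5.37), (5.39)–(5.40) p. 305] -/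
theorem exists_goodTranslates_family (D Sp : Finset (Site d)) {μ ν ℓ : Fin d} (hμ : ℓ ≠ μ) (hν : ℓ ≠ ν) {N : ℕ}
    {c10 q c11 : ℕ} (hc : c10 + q + D.card ≤ c11) (hN : 2 * c11 + 1 ≤ N) (c : Site d) :
    ∃ (X : Finset (Site d)) (F : Site d → Finset (Site d)), X ⊆ block N c ∧
      X.card ≤ (2 * c11 + 1) * (4 * N) * D.card + (2 * c11 + 1) * Sp.card / (q + 1) ∧
      (∀ y ∈ block N c, y ∉ X → (F y).card = c10 ∧ ∀ g ∈ F y, g ∈ block N c ∧ g ∉ Sp ∧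
        (∃ j : ℤ, |j| ≤ c11 ∧ g = y + j • ev ℓ) ∧
        (∀ p ∈ rectPlaqs g μ ν N N, p.1 ∉ D) ∧ (∀ l ∈ rectLoop g μ ν N N, l.1.1 ∉ D) ∧
        ∃ t : ℕ, 0 < t ∧ t ≤ c11 ∧
          ((g = y + (t : ℤ) • ev ℓ ∧ ∀ q' ∈ slabPlaqs ℓ (rectLoop y μ ν N N) t, q'.1 ∉ D) ∨
           (g = y + (-(t : ℤ)) • ev ℓ ∧ ∀ q' ∈ slabPlaqs ℓ (rectLoop g μ ν N N) t, q'.1 ∉ D))) ∧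
      ∀ (Bad : Finset (Site d)) (g : Site d), GoodSquareReweighting.mult Bad F g ≤ 2 * c11 + 1 := by
  classical
  obtain ⟨X, hXY, hXc, hX⟩ := exists_exclusion D Sp (block N c) μ ν ℓ N q c11
  -- the selection, corner by corner (empty off the kept corners)
  have key : ∀ y : Site d, ∃ Fy : Finset (Site d), (∀ g ∈ Fy, ∃ j : ℤ, |j| ≤ c11 ∧ g = y + j • ev ℓ) ∧
      (y ∈ block N c → y ∉ X → Fy.card = c10 ∧ ∀ g ∈ Fy, g ∈ block N c ∧ g ∉ Sp ∧
        (∃ j : ℤ, |j| ≤ c11 ∧ g = y + j • ev ℓ) ∧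
        (∀ p ∈ rectPlaqs g μ ν N N, p.1 ∉ D) ∧ (∀ l ∈ rectLoop g μ ν N N, l.1.1 ∉ D) ∧
        ∃ t : ℕ, 0 < t ∧ t ≤ c11 ∧
          ((g = y + (t : ℤ) • ev ℓ ∧ ∀ q' ∈ slabPlaqs ℓ (rectLoop y μ ν N N) t, q'.1 ∉ D) ∨
           (g = y + (-(t : ℤ)) • ev ℓ ∧ ∀ q' ∈ slabPlaqs ℓ (rectLoop g μ ν N N) t, q'.1 ∉ D))) := by
    intro y
    by_cases hy : y ∈ block N c ∧ y ∉ X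
    · obtain ⟨hl, hs⟩ := hX y hy.1 hy.2
      obtain ⟨F, hFc, hF⟩ := exists_goodTranslates_block D Sp hμ hν hc hN hy.1 hl hs
      exact ⟨F, fun g hg => (hF g hg).2.2.1, fun _ _ => ⟨hFc, hF⟩⟩
    · exact ⟨∅, fun g hg => by simp at hg, fun h1 h2 => (hy ⟨h1, h2⟩).elim⟩
  choose F hFtr hF using key
  refine ⟨X, F, hXY, hXc, fun y hy hyX => hF y hy hyX, fun Bad g => ?_⟩
  exact GoodSquareReweighting.mult_le_of_translates Bad F ℓ c11 (fun b _ g hg => hFtr b g hg) g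

/-! ## §6 (v1.1) The multiplicity is at most `#D`: (5.37) with `ε = #D/c₁₀`, «c₁₀ … large enough (as a function of ε)» -/

/-- A translate along `e_ℓ` is recovered from its `ℓ`-coordinate: `b = g + (b_ℓ − g_ℓ) e_ℓ` when `g = b + j e_ℓ`.
[cite: Federbush1987PhaseCellIII, §5.3 11) p. 305] -/
theorem eq_add_sub_smul_of_translate {ℓ : Fin d} {b g : Site d} {j : ℤ} (hj : g = b + j • ev ℓ) :
    b = g + (b ℓ - g ℓ) • ev ℓ := by
  funext i
  by_cases hi : i = ℓ
  · subst hi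
    simp [hj, Pi.add_apply]
  · simp [hj, Pi.add_apply, ev_apply_of_ne hi]

/-- **A good square is a translate of at most `#D` BAD squares**: if every square of `Bad` has an interior plaquette based at
a removed point and every family `F b` consists of translates of `b` along `e_ℓ` (`ℓ ∉ {μ, ν}`), then
`mult Bad F g ≦ #D` for EVERY `g` — independently of `c₁₀` and `c₁₁` (one removed point spoils the interior of at most one
translate, `card_filter_interior_le`).  Hence (5.37) holds with `ε = #D/c₁₀` (`GoodSquareReweighting.weight_le`), small once
«c₁₀ is picked large enough (as a function of ε)» — print's order of constants; the generic `2c₁₁ + 1` of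
`mult_le_of_translates`/`exists_goodTranslates_family` would not do, `c₁₁` growing with `c₁₀`.
[cite: Federbush1987PhaseCellIII, §5.3 10)–11) (5.37) p. 305] -/
theorem mult_le_card_removed (D Bad : Finset (Site d)) (F : Site d → Finset (Site d)) {μ ν ℓ : Fin d} (hμ : ℓ ≠ μ)
    (hν : ℓ ≠ ν) (N : ℕ) (hBad : ∀ b ∈ Bad, ∃ p ∈ rectPlaqs b μ ν N N, p.1 ∈ D)
    (hF : ∀ b ∈ Bad, ∀ g ∈ F b, ∃ j : ℤ, g = b + j • ev ℓ) (g : Site d) :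
    GoodSquareReweighting.mult Bad F g ≤ D.card := by
  classical
  rw [GoodSquareReweighting.mult_def]
  set W : Finset ℤ := (Bad.filter fun b => g ∈ F b).image fun b => b ℓ - g ℓ with hW
  have key : (Bad.filter fun b => g ∈ F b).card ≤
      (W.filter fun h : ℤ => ∃ p ∈ rectPlaqs (g + h • ev ℓ) μ ν N N, p.1 ∈ D).card := by
    refine Finset.card_le_card_of_injOn (fun b => b ℓ - g ℓ) (fun b hb => ?_) ?_
    · obtain ⟨hbB, hgF⟩ := Finset.mem_filter.1 (Finset.mem_coe.1 hb)
      obtain ⟨j, hj⟩ := hF b hbB g hgF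
      refine Finset.mem_coe.2 (Finset.mem_filter.2 ⟨Finset.mem_image.2 ⟨b, Finset.mem_filter.2 ⟨hbB, hgF⟩, rfl⟩, ?_⟩)
      rw [← eq_add_sub_smul_of_translate hj]
      exact hBad b hbB
    · intro b hb b' hb' h
      obtain ⟨hbB, hgF⟩ := Finset.mem_filter.1 (Finset.mem_coe.1 hb)
      obtain ⟨hbB', hgF'⟩ := Finset.mem_filter.1 (Finset.mem_coe.1 hb')
      obtain ⟨j, hj⟩ := hF b hbB g hgF
      obtain ⟨j', hj'⟩ := hF b' hbB' g hgF'
      have e1 := eq_add_sub_smul_of_translate hj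
      have e2 := eq_add_sub_smul_of_translate hj'
      have h' : b ℓ - g ℓ = b' ℓ - g ℓ := h
      rw [e1, e2, h']
  exact key.trans (card_filter_interior_le D hμ hν g N W)

/-- **The kept bad squares have multiplicity `≦ #D` in the families of `exists_goodTranslates_family`.**  For the exclusion set
`X` and families `F` of that theorem (all that is used: `F y` consists of translates of `y` along `e_ℓ` for `y ∈ block N c ∖ X`)
and any `Bad ⊆ block N c ∖ X` whose squares have an interior plaquette based in `D`: `mult Bad F g ≦ #D` for every `g`.
[cite: Federbush1987PhaseCellIII, §5.3 10)–11) (5.37) p. 305] -/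
theorem mult_le_card_removed_of_kept (D Bad X : Finset (Site d)) (F : Site d → Finset (Site d)) {μ ν ℓ : Fin d} (hμ : ℓ ≠ μ)
    (hν : ℓ ≠ ν) {N : ℕ} {c11 : ℕ} {c : Site d}
    (hF : ∀ y ∈ block N c, y ∉ X → ∀ g ∈ F y, ∃ j : ℤ, |j| ≤ c11 ∧ g = y + j • ev ℓ)
    (hBadK : ∀ b ∈ Bad, b ∈ block N c ∧ b ∉ X) (hBad : ∀ b ∈ Bad, ∃ p ∈ rectPlaqs b μ ν N N, p.1 ∈ D) (g : Site d) :
    GoodSquareReweighting.mult Bad F g ≤ D.card :=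
  mult_le_card_removed D Bad F hμ hν N hBad (fun b hb g' hg' => by
    obtain ⟨j, -, hj⟩ := hF b (hBadK b hb).1 (hBadK b hb).2 g' hg'
    exact ⟨j, hj⟩) g

end GoodSquareTranslates

end Literature.MathematicalPhysics.QuantumFieldTheory.Federbush1986
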